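import Summits.QuantumFields.QCD.Theorems.SpectralDefectExtinctionWegnerEstimateCoareaCircleArea
import Summits.QuantumFields.QCD.Theorems.SpectralDefectExtinctionWegnerEstimateCoareaHellmannFeynman

/-!
# Bridge lemmas T (transport to the glued cell) toward stub `coareaWegner` of line `Sketch`
(skeleton "ResolventCell", gen 2) for crux `SpectralDefectExtinction.WegnerEstimate` (item stmt-QuantumFields-8966)

The abstract core N₂ (`CoareaCore`) sees, for a cell configuration `V`, a cell link `ed` and a link
curve `c`, the family `s ↦ H(glue_{x,R}(U, V[ed ↦ V(ed) c(s)]))` of Hermitian Wilson operators of the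
GLUED field.  Since updating a cell link commutes with gluing the exterior
(`coareaWegner_glue_circle`: `glue(V[ed ↦ V(ed) g]) = (glue V)[ed ↦ (glue V)(ed) g]`), this is the
one-link circle of the glued field `W = glue V`, to which the landed bridges apply:
A (Hellmann–Feynman current identity, `CoareaHellmannFeynman`), H (Lipschitz sorted eigenvalues) and
M (area bound `4656 π`) (`CoareaCircleArea`), H′ (trigonometric families, `CoareaCircleAffine`,
`CoareaWeylLipschitz`).  This file states the bridges with the link as ONE edge argument and the global
Hermitian-ness family (§2), transports them to the glued-cell families in exactly the shape the core's
hypotheses take after instantiation (§3), and reindexes the direction sum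
`Σ_{y ∈ box} Σ_μ Σ_i = Σ_{d : (↥box × Fin 4) × Fin 8}` (§4).
-/

noncomputable section

namespace Summit.QuantumFields.QCD.Cruxes.WegnerEstimate.ResolventCell

open MeasureTheory Filter
open scoped Matrix BigOperators ENNReal NNReal Topology
open Literature.MathematicalPhysics.QuantumLattice Literature.MathematicalPhysics.QuantumFieldTheory
  Literature.Probability.LatticeModels
open Literature.Barriers.QuantumFields (isHermitian_gammaFive_mul_wilsonDirac)
open Matrix
open scoped ComplexOrder

/-! ### §1 Glue/update commutation -/

/-- Updating a cell link commutes with gluing the exterior, and the glued field agrees with the cell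
configuration on cell links: `glue(V[e ↦ V(e) g]) = (glue V)[e ↦ (glue V)(e) g]`. -/
theorem coareaWegner_glue_circle {L : ℕ} [NeZero L] (R : ℕ) (x : TorusSite 4 L) (U V : GaugeConfig 4 L SU3)
    (e : Edge 4 L) (he : ∃ y ∈ box 4 R, e.1 = x + Torus.proj L y) (g : SU3) :
    (fun e' : Edge 4 L => if (∃ y ∈ box 4 R, e'.1 = x + Torus.proj L y) then
        Function.update V e (V e * g) e' else U e' : GaugeConfig 4 L SU3) =
      Function.update (fun e' : Edge 4 L => if (∃ y ∈ box 4 R, e'.1 = x + Torus.proj L y) then V e' else U e')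
        e ((fun e' : Edge 4 L => if (∃ y ∈ box 4 R, e'.1 = x + Torus.proj L y) then V e' else U e') e * g) := by
  funext e'
  by_cases h : e' = e
  · subst h
    simp only [Function.update_self, if_pos he]
  · rw [Function.update_of_ne h, Function.update_of_ne h]

/-! ### §2 Edge-argument forms of the bridges H, H′, M

The landed bridges take a link as a pair `(z, μ)`; the abstract core sees links as single terms
`e d : Edge 4 L`.  The forms below take the link as one argument `ed` and the GLOBAL Hermitian-ness
family `herm`, so that all later instantiations are by variables only. -/

/-- Bridge H along a link given as one edge argument: sorted eigenvalues along a trigonometric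
one-link circle are uniformly Lipschitz. -/
theorem coareaWegner_edge_eigenvalues₀_lipschitz {L : ℕ} [NeZero L] (W : GaugeConfig 4 L SU3) (m₀ : ℝ)
    (ed : Edge 4 L) (c : ℝ → SU3) (δ₀ δ₁ δ₂ : Matrix (Fin 3) (Fin 3) ℂ)
    (hc : ∀ t, ((c t : SU3) : Matrix (Fin 3) (Fin 3) ℂ) =
      δ₀ + ((Real.cos t : ℝ) : ℂ) • δ₁ + ((Real.sin t : ℝ) : ℂ) • δ₂)
    (herm : ∀ W' : GaugeConfig 4 L SU3,
      (spinorLift gammaFive * wilsonDirac (fundamentalRep (Fin 3)) W' m₀ 1).IsHermitian) :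
    ∃ K : ℝ≥0, ∀ i : Fin (Fintype.card (QuarkIdx L)),
      LipschitzWith K (fun s => (herm (Function.update W ed (W ed * c s))).eigenvalues₀ i) := by
  obtain ⟨z, μ⟩ := ed
  exact coareaWegner_oneLinkCircle_eigenvalues₀_lipschitz W m₀ z μ c δ₀ δ₁ δ₂ hc (fun s => herm _)

/-- Bridge H′ along a link given as one edge argument: the Hermitian Wilson operator along a
trigonometric one-link circle is entrywise differentiable at `s = 0`. -/
theorem coareaWegner_edge_hasDerivAt_entry {L : ℕ} [NeZero L] (W : GaugeConfig 4 L SU3) (m₀ : ℝ)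
    (ed : Edge 4 L) (c : ℝ → SU3) (δ₀ δ₁ δ₂ : Matrix (Fin 3) (Fin 3) ℂ)
    (hc : ∀ t, ((c t : SU3) : Matrix (Fin 3) (Fin 3) ℂ) =
      δ₀ + ((Real.cos t : ℝ) : ℂ) • δ₁ + ((Real.sin t : ℝ) : ℂ) • δ₂) :
    ∃ Hd : Matrix (QuarkIdx L) (QuarkIdx L) ℂ, ∀ p q : QuarkIdx L,
      HasDerivAt (fun s : ℝ => (spinorLift gammaFive * wilsonDirac (fundamentalRep (Fin 3))
        (Function.update W ed (W ed * c s)) m₀ 1 : Matrix (QuarkIdx L) (QuarkIdx L) ℂ) p q) (Hd p q) 0 := by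
  obtain ⟨z, μ⟩ := ed
  obtain ⟨H₀, H₁, H₂, hfam⟩ := coareaWegner_oneLinkCircle_affine W m₀ z μ c δ₀ δ₁ δ₂ hc
  refine ⟨((-Real.sin 0 : ℝ) : ℂ) • H₁ + ((Real.cos 0 : ℝ) : ℂ) • H₂, fun p q => ?_⟩
  have hfun : (fun s : ℝ => (spinorLift gammaFive * wilsonDirac (fundamentalRep (Fin 3))
      (Function.update W (z, μ) (W (z, μ) * c s)) m₀ 1 : Matrix (QuarkIdx L) (QuarkIdx L) ℂ) p q) =
      fun s : ℝ => (H₀ + ((Real.cos s : ℝ) : ℂ) • H₁ + ((Real.sin s : ℝ) : ℂ) • H₂) p q := by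
    funext s
    rw [hfam s]
  rw [hfun]
  exact coareaWegner_trigFamily_hasDerivAt H₀ H₁ H₂ 0 p q

/-- Bridge M along a link given as one edge argument: the area bound `4656 π` along a `2π`-periodic
trigonometric one-link circle. -/
theorem coareaWegner_edge_areaBound
    (hzero : ∀ (N r : ℕ) (A : Matrix (Fin N) (Fin N) ℂ) (B : Matrix (Fin N) (Fin r) ℂ) (C : Matrix (Fin r) (Fin N) ℂ)
      (δ₀ δ₁ δ₂ : Matrix (Fin r) (Fin r) ℂ),
      (∀ t : ℝ, (A + B * (δ₀ + ((Real.cos t : ℝ) : ℂ) • δ₁ + ((Real.sin t : ℝ) : ℂ) • δ₂) * C).det = 0) ∨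
      ({t : ℝ | t ∈ Set.Ico (0 : ℝ) (2 * Real.pi) ∧
          (A + B * (δ₀ + ((Real.cos t : ℝ) : ℂ) • δ₁ + ((Real.sin t : ℝ) : ℂ) • δ₂) * C).det = 0}.Finite ∧
        {t : ℝ | t ∈ Set.Ico (0 : ℝ) (2 * Real.pi) ∧
          (A + B * (δ₀ + ((Real.cos t : ℝ) : ℂ) • δ₁ + ((Real.sin t : ℝ) : ℂ) • δ₂) * C).det = 0}.ncard ≤ 2 * r))
    {L : ℕ} [NeZero L] (W : GaugeConfig 4 L SU3) (m₀ : ℝ) (ed : Edge 4 L) (c : ℝ → SU3)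
    (δ₀ δ₁ δ₂ : Matrix (Fin 3) (Fin 3) ℂ)
    (hc : ∀ t, ((c t : SU3) : Matrix (Fin 3) (Fin 3) ℂ) =
      δ₀ + ((Real.cos t : ℝ) : ℂ) • δ₁ + ((Real.sin t : ℝ) : ℂ) • δ₂)
    (hper : ∀ t, c (t + 2 * Real.pi) = c t)
    (herm : ∀ W' : GaugeConfig 4 L SU3,
      (spinorLift gammaFive * wilsonDirac (fundamentalRep (Fin 3)) W' m₀ 1).IsHermitian)
    {ε : ℝ} (hε : 0 < ε) :
    ∑ i : Fin (Fintype.card (QuarkIdx L)), ∫⁻ t in Set.Icc 0 (2 * Real.pi),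
      ENNReal.ofReal (|deriv (fun s => (herm (Function.update W ed (W ed * c s))).eigenvalues₀ i) t| *
        (ε / ((herm (Function.update W ed (W ed * c t))).eigenvalues₀ i ^ 2 + ε ^ 2))) ≤
      ENNReal.ofReal (4656 * Real.pi) := by
  obtain ⟨z, μ⟩ := ed
  exact coareaWegner_oneLinkCircle_areaBound hzero W m₀ z μ c δ₀ δ₁ δ₂ hc hper (fun s => herm _) hε

/-! ### §3 Transport to the glued-cell families

For a cell configuration `V`, a cell link `ed` and a link curve `c`, the abstract core sees the family
`s ↦ H(glue(V[ed ↦ V(ed) c(s)]))`; by `coareaWegner_glue_circle` this is the one-link circle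
`s ↦ H((glue V)[ed ↦ (glue V)(ed) c(s)])` of the glued field, to which the bridges apply. -/

/-- Transport of bridge H: sorted eigenvalues of the glued cell along a one-link circle are Lipschitz. -/
theorem coareaWegner_glued_eigenvalues₀_lipschitz {L : ℕ} [NeZero L] (R : ℕ) (x : TorusSite 4 L)
    (U V : GaugeConfig 4 L SU3) (m₀ : ℝ) (ed : Edge 4 L) (hed : ∃ y ∈ box 4 R, ed.1 = x + Torus.proj L y)
    (c : ℝ → SU3) (δ₀ δ₁ δ₂ : Matrix (Fin 3) (Fin 3) ℂ)
    (hc : ∀ t, ((c t : SU3) : Matrix (Fin 3) (Fin 3) ℂ) =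
      δ₀ + ((Real.cos t : ℝ) : ℂ) • δ₁ + ((Real.sin t : ℝ) : ℂ) • δ₂)
    (herm : ∀ W' : GaugeConfig 4 L SU3,
      (spinorLift gammaFive * wilsonDirac (fundamentalRep (Fin 3)) W' m₀ 1).IsHermitian) :
    ∃ K : ℝ≥0, ∀ i : Fin (Fintype.card (QuarkIdx L)), LipschitzWith K fun s =>
      (herm (fun e : Edge 4 L => if (∃ y ∈ box 4 R, e.1 = x + Torus.proj L y) then
        Function.update V ed (V ed * c s) e else U e)).eigenvalues₀ i := by
  have key := fun g : SU3 => coareaWegner_glue_circle R x U V ed hed g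
  obtain ⟨K, hK⟩ := coareaWegner_edge_eigenvalues₀_lipschitz
    (fun e : Edge 4 L => if (∃ y ∈ box 4 R, e.1 = x + Torus.proj L y) then V e else U e) m₀ ed c δ₀ δ₁ δ₂ hc herm
  refine ⟨K, fun i => ?_⟩
  have hfun : (fun s : ℝ => (herm (fun e : Edge 4 L => if (∃ y ∈ box 4 R, e.1 = x + Torus.proj L y) then
        Function.update V ed (V ed * c s) e else U e)).eigenvalues₀ i) =
      fun s : ℝ => (herm (Function.update
        (fun e : Edge 4 L => if (∃ y ∈ box 4 R, e.1 = x + Torus.proj L y) then V e else U e) ed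
        ((fun e : Edge 4 L => if (∃ y ∈ box 4 R, e.1 = x + Torus.proj L y) then V e else U e) ed * c s))).eigenvalues₀
          i := by
    funext s
    exact congrFun (coareaWegner_eigenvalues₀_congr _ _ (congrArg
      (fun W' : GaugeConfig 4 L SU3 => spinorLift gammaFive * wilsonDirac (fundamentalRep (Fin 3)) W' m₀ 1)
      (key (c s)))) i
  rw [hfun]
  exact hK i

/-- Transport of bridge H′: the Hermitian Wilson operator of the glued cell along a one-link circle is
entrywise differentiable at `s = 0`. -/
theorem coareaWegner_glued_hasDerivAt_entry {L : ℕ} [NeZero L] (R : ℕ) (x : TorusSite 4 L)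
    (U V : GaugeConfig 4 L SU3) (m₀ : ℝ) (ed : Edge 4 L) (hed : ∃ y ∈ box 4 R, ed.1 = x + Torus.proj L y)
    (c : ℝ → SU3) (δ₀ δ₁ δ₂ : Matrix (Fin 3) (Fin 3) ℂ)
    (hc : ∀ t, ((c t : SU3) : Matrix (Fin 3) (Fin 3) ℂ) =
      δ₀ + ((Real.cos t : ℝ) : ℂ) • δ₁ + ((Real.sin t : ℝ) : ℂ) • δ₂) :
    ∃ Hd : Matrix (QuarkIdx L) (QuarkIdx L) ℂ, ∀ p q : QuarkIdx L,
      HasDerivAt (fun s : ℝ => (spinorLift gammaFive * wilsonDirac (fundamentalRep (Fin 3))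
        (fun e : Edge 4 L => if (∃ y ∈ box 4 R, e.1 = x + Torus.proj L y) then
          Function.update V ed (V ed * c s) e else U e) m₀ 1 : Matrix (QuarkIdx L) (QuarkIdx L) ℂ) p q)
        (Hd p q) 0 := by
  have key := fun g : SU3 => coareaWegner_glue_circle R x U V ed hed g
  obtain ⟨Hd, hHd⟩ := coareaWegner_edge_hasDerivAt_entry
    (fun e : Edge 4 L => if (∃ y ∈ box 4 R, e.1 = x + Torus.proj L y) then V e else U e) m₀ ed c δ₀ δ₁ δ₂ hc
  refine ⟨Hd, fun p q => ?_⟩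
  have hfun : (fun s : ℝ => (spinorLift gammaFive * wilsonDirac (fundamentalRep (Fin 3))
        (fun e : Edge 4 L => if (∃ y ∈ box 4 R, e.1 = x + Torus.proj L y) then
          Function.update V ed (V ed * c s) e else U e) m₀ 1 : Matrix (QuarkIdx L) (QuarkIdx L) ℂ) p q) =
      fun s : ℝ => (spinorLift gammaFive * wilsonDirac (fundamentalRep (Fin 3)) (Function.update
        (fun e : Edge 4 L => if (∃ y ∈ box 4 R, e.1 = x + Torus.proj L y) then V e else U e) ed
        ((fun e : Edge 4 L => if (∃ y ∈ box 4 R, e.1 = x + Torus.proj L y) then V e else U e) ed * c s)) m₀ 1 :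
          Matrix (QuarkIdx L) (QuarkIdx L) ℂ) p q := by
    funext s
    rw [key (c s)]
  rw [hfun]
  exact hHd p q

/-- Transport of bridge M: the area bound `4656 π` along a one-link circle of the glued cell. -/
theorem coareaWegner_glued_areaBound
    (hzero : ∀ (N r : ℕ) (A : Matrix (Fin N) (Fin N) ℂ) (B : Matrix (Fin N) (Fin r) ℂ) (C : Matrix (Fin r) (Fin N) ℂ)
      (δ₀ δ₁ δ₂ : Matrix (Fin r) (Fin r) ℂ),
      (∀ t : ℝ, (A + B * (δ₀ + ((Real.cos t : ℝ) : ℂ) • δ₁ + ((Real.sin t : ℝ) : ℂ) • δ₂) * C).det = 0) ∨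
      ({t : ℝ | t ∈ Set.Ico (0 : ℝ) (2 * Real.pi) ∧
          (A + B * (δ₀ + ((Real.cos t : ℝ) : ℂ) • δ₁ + ((Real.sin t : ℝ) : ℂ) • δ₂) * C).det = 0}.Finite ∧
        {t : ℝ | t ∈ Set.Ico (0 : ℝ) (2 * Real.pi) ∧
          (A + B * (δ₀ + ((Real.cos t : ℝ) : ℂ) • δ₁ + ((Real.sin t : ℝ) : ℂ) • δ₂) * C).det = 0}.ncard ≤ 2 * r))
    {L : ℕ} [NeZero L] (R : ℕ) (x : TorusSite 4 L)
    (U V : GaugeConfig 4 L SU3) (m₀ : ℝ) (ed : Edge 4 L) (hed : ∃ y ∈ box 4 R, ed.1 = x + Torus.proj L y)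
    (c : ℝ → SU3) (δ₀ δ₁ δ₂ : Matrix (Fin 3) (Fin 3) ℂ)
    (hc : ∀ t, ((c t : SU3) : Matrix (Fin 3) (Fin 3) ℂ) =
      δ₀ + ((Real.cos t : ℝ) : ℂ) • δ₁ + ((Real.sin t : ℝ) : ℂ) • δ₂)
    (hper : ∀ t, c (t + 2 * Real.pi) = c t)
    (herm : ∀ W' : GaugeConfig 4 L SU3,
      (spinorLift gammaFive * wilsonDirac (fundamentalRep (Fin 3)) W' m₀ 1).IsHermitian)
    {ε : ℝ} (hε : 0 < ε) :
    ∑ i : Fin (Fintype.card (QuarkIdx L)), ∫⁻ t in Set.Icc 0 (2 * Real.pi),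
      ENNReal.ofReal (|deriv (fun s => (herm (fun e : Edge 4 L => if (∃ y ∈ box 4 R, e.1 = x + Torus.proj L y) then
          Function.update V ed (V ed * c s) e else U e)).eigenvalues₀ i) t| *
        (ε / ((herm (fun e : Edge 4 L => if (∃ y ∈ box 4 R, e.1 = x + Torus.proj L y) then
          Function.update V ed (V ed * c t) e else U e)).eigenvalues₀ i ^ 2 + ε ^ 2))) ≤
      ENNReal.ofReal (4656 * Real.pi) := by
  have key := fun g : SU3 => coareaWegner_glue_circle R x U V ed hed g
  have hM := coareaWegner_edge_areaBound hzero
    (fun e : Edge 4 L => if (∃ y ∈ box 4 R, e.1 = x + Torus.proj L y) then V e else U e) m₀ ed c δ₀ δ₁ δ₂ hc hper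
    herm hε
  have hpt : ∀ (s : ℝ) (i : Fin (Fintype.card (QuarkIdx L))),
      (herm (fun e : Edge 4 L => if (∃ y ∈ box 4 R, e.1 = x + Torus.proj L y) then
          Function.update V ed (V ed * c s) e else U e)).eigenvalues₀ i =
        (herm (Function.update
          (fun e : Edge 4 L => if (∃ y ∈ box 4 R, e.1 = x + Torus.proj L y) then V e else U e) ed
          ((fun e : Edge 4 L => if (∃ y ∈ box 4 R, e.1 = x + Torus.proj L y) then V e else U e) ed * c s))).eigenvalues₀
            i := fun s i =>
    congrFun (coareaWegner_eigenvalues₀_congr _ _ (congrArg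
      (fun W' : GaugeConfig 4 L SU3 => spinorLift gammaFive * wilsonDirac (fundamentalRep (Fin 3)) W' m₀ 1)
      (key (c s)))) i
  have hfun : ∀ i : Fin (Fintype.card (QuarkIdx L)),
      (fun s : ℝ => (herm (fun e : Edge 4 L => if (∃ y ∈ box 4 R, e.1 = x + Torus.proj L y) then
          Function.update V ed (V ed * c s) e else U e)).eigenvalues₀ i) =
        fun s : ℝ => (herm (Function.update
          (fun e : Edge 4 L => if (∃ y ∈ box 4 R, e.1 = x + Torus.proj L y) then V e else U e) ed
          ((fun e : Edge 4 L => if (∃ y ∈ box 4 R, e.1 = x + Torus.proj L y) then V e else U e) ed * c s))).eigenvalues₀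
            i := fun i => funext fun s => hpt s i
  refine le_trans (le_of_eq ?_) hM
  refine Finset.sum_congr rfl fun i _ => ?_
  refine lintegral_congr fun t => ?_
  rw [hfun i, hpt t i]

/-- Transport of bridge A (Hellmann–Feynman): along the one-link circle of a cell link through the glued
cell, the quadratic form of any field has `s`-derivative at `0` equal to the colour current — in the
verbatim shape of `stub_currentRigidity` (sites `x + proj y`, `y ∈ box 4 R`). -/
theorem coareaWegner_glued_hellmannFeynman {L : ℕ} [NeZero L] (R : ℕ) (x : TorusSite 4 L)
    (U V : GaugeConfig 4 L SU3) (m₀ : ℝ) (y : Fin 4 → ℤ) (hy : y ∈ box 4 R) (μ : Fin 4)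
    (X : Matrix (Fin 3) (Fin 3) ℂ) (c : ℝ → SU3)
    (hcX : ∀ a b : Fin 3, HasDerivAt (fun t => ((c t : SU3) : Matrix (Fin 3) (Fin 3) ℂ) a b) (X a b) 0)
    (ψ : QuarkIdx L → ℂ) :
    HasDerivAt (fun s : ℝ => (star ψ ⬝ᵥ (spinorLift gammaFive * wilsonDirac (fundamentalRep (Fin 3))
        (fun e : Edge 4 L => if (∃ y ∈ box 4 R, e.1 = x + Torus.proj L y) then
          Function.update V (x + Torus.proj L y, μ) (V (x + Torus.proj L y, μ) * c s) e else U e) m₀ 1).mulVec ψ).re)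
      (2 * (∑ a : Fin 3, ∑ b : Fin 3, ∑ α : Fin 4, ∑ β : Fin 4,
        star (ψ (x + Torus.proj L y, a, α)) *
          (gammaFive * ((-(1 / 2 : ℂ)) • ((1 : Matrix (Fin 4) (Fin 4) ℂ) - euclideanGamma μ))) α β *
          ((((fun e : Edge 4 L => if (∃ y ∈ box 4 R, e.1 = x + Torus.proj L y) then V e else U e)
              (x + Torus.proj L y, μ) : SU3) : Matrix (Fin 3) (Fin 3) ℂ) * X) a b *
          ψ (Literature.MathematicalPhysics.QuantumFieldTheory.Site.shift (x + Torus.proj L y) μ, b, β)).re) 0 := by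
  have hcell : ∃ y' ∈ box 4 R, ((x + Torus.proj L y, μ) : Edge 4 L).1 = x + Torus.proj L y' := ⟨y, hy, rfl⟩
  have hA := coareaWegner_hellmannFeynman
    (fun e : Edge 4 L => if (∃ y ∈ box 4 R, e.1 = x + Torus.proj L y) then V e else U e) m₀
    (x + Torus.proj L y) μ X c hcX ψ
  have hfun : (fun s : ℝ => (star ψ ⬝ᵥ (spinorLift gammaFive * wilsonDirac (fundamentalRep (Fin 3))
      (fun e : Edge 4 L => if (∃ y ∈ box 4 R, e.1 = x + Torus.proj L y) then
        Function.update V (x + Torus.proj L y, μ) (V (x + Torus.proj L y, μ) * c s) e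
        else U e) m₀ 1).mulVec ψ).re) =
      fun t : ℝ => (star ψ ⬝ᵥ (spinorLift gammaFive * wilsonDirac (fundamentalRep (Fin 3))
        (Function.update (fun e : Edge 4 L => if (∃ y ∈ box 4 R, e.1 = x + Torus.proj L y) then V e else U e)
          (x + Torus.proj L y, μ)
          ((fun e : Edge 4 L => if (∃ y ∈ box 4 R, e.1 = x + Torus.proj L y) then V e else U e)
            (x + Torus.proj L y, μ) * c t)) m₀ 1).mulVec ψ).re := by
    funext s
    rw [coareaWegner_glue_circle R x U V _ hcell]
  rw [hfun]
  exact hA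

/-! ### §4 Reindexing the directions -/

/-- Reindexing the direction sum: `Σ_{y ∈ s} Σ_μ Σ_i f y μ i = Σ_{d : (↥s × Fin 4) × Fin 8} f d.1.1 d.1.2 d.2`. -/
theorem coareaWegner_sum_box_dir {M : Type*} [AddCommMonoid M] {σ : Type*} (s : Finset σ)
    (f : σ → Fin 4 → Fin 8 → M) :
    ∑ y ∈ s, ∑ μ : Fin 4, ∑ i : Fin 8, f y μ i = ∑ d : (↥s × Fin 4) × Fin 8, f (d.1.1 : σ) d.1.2 d.2 := by
  rw [← Finset.sum_coe_sort s, ← Fintype.sum_prod_type', ← Fintype.sum_prod_type']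

end Summit.QuantumFields.QCD.Cruxes.WegnerEstimate.ResolventCell

end
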